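import Mathlib.Analysis.Fourier.AddCircleMulti
import Mathlib.Algebra.Module.ZLattice.Covolume
import Mathlib.MeasureTheory.Group.FundamentalDomain
import Mathlib.Topology.Algebra.Group.Quotient
import HarnessLib

/-!
# Continuous periodic functions for a full lattice: mean, characters, density of trigonometric
polynomials, periodization, and Weyl's criterion with weights

Topic `Literature/Algebra/EuclideanLattices`. For a full `ℤ`-lattice `L` in a finite-dimensional real
normed space `E` (with a Haar measure `μ`) we set up, with proofs:

* `zBasis L`, `rBasis L` — a `ℤ`-basis of `L` indexed by `Fin (finrank ℝ E)` and the same vectors as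
  an `ℝ`-basis of `E`; `fdom L` — the attached fundamental parallelepiped, an
  `IsAddFundamentalDomain` for the translation action of `L`;
* `mean L μ g = (μ(fdom))⁻¹ ∫_{fdom} g` — the mean of a function over a period;
* `echar L k x = exp(2πi ∑ kᵢ xᵢ)` (`xᵢ` the coordinates of `x` in `rBasis`) — the characters of
  `E/L`, `k : Fin n → ℤ`; `mean_echar`: the mean of a non-trivial character is `0` (translation
  trick);
* `exists_trigPoly_approx` — **density**: a continuous `L`-periodic `g : E → ℂ` is a uniform limit
  of trigonometric polynomials `∑ c_k echar k` (transport to Mathlib's `UnitAddTorus` and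
  `UnitAddTorus.span_mFourier_closure_eq_top`, i.e. Stone–Weierstrass);
* `periodize L h x = ∑' ℓ : L, h (x + ℓ)` for compactly supported `h`: continuity, periodicity,
  monotonicity and the **unfolding** `∫_{fdom} periodize h = ∫ h` (`integral_fdom_periodize`);
* **Weyl's criterion with weights and a normalisation** (`tendsto_sum_of_tendsto_echar`): if a
  family of finite multisets of points `y i`, `i ∈ S m`, `m = 1, 2, …` satisfies
  `(∑_{m ≤ x} ∑_{i ∈ S m} echar k (y i)) (log x)^κ / x → c·[k = 0]` for every `k`, then
  `(∑_{m ≤ x} ∑_{i ∈ S m} g (y i)) (log x)^κ / x → c · mean g` for every continuous periodic real `g`.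

These are the torus-side tools of Hecke's equidistribution theorem for the prime ideals of a
number field in the "Grössencharakter angles" (Hecke 1920, §6–§7; Mitsui 1956).

## References

* H. Weyl, *Über die Gleichverteilung von Zahlen mod. Eins*, Math. Ann. 77 (1916), 313–352, §1, §7.
* E. Hecke, *Eine neue Art von Zetafunktionen und ihre Beziehungen zur Verteilung der Primzahlen*
  II, Math. Z. 6 (1920), 11–51, §6. [HeckeMathZ1920]
-/

noncomputable section

open MeasureTheory Module Submodule Filter Topology Complex Finset ZSpan

open scoped Real

namespace Literature.Algebra.EuclideanLattices.LatticePeriodic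

variable {E : Type*} [NormedAddCommGroup E] [NormedSpace ℝ E] [FiniteDimensional ℝ E]
variable (L : Submodule ℤ E) [DiscreteTopology L] [IsZLattice ℝ L]

/-! ## A basis and a fundamental domain -/

/-- A `ℤ`-basis of the lattice indexed by `Fin (finrank ℝ E)`. [folklore] -/
def zBasis : Basis (Fin (finrank ℝ E)) ℤ L :=
  haveI := ZLattice.module_free ℝ L
  haveI := ZLattice.module_finite ℝ L
  (Module.finBasis ℤ L).reindex (finCongr (ZLattice.rank ℝ L))

/-- The same vectors as an `ℝ`-basis of `E`. [folklore] -/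
def rBasis : Basis (Fin (finrank ℝ E)) ℝ E := (zBasis L).ofZLatticeBasis ℝ L

/-- The `ℤ`-span of `rBasis` is `L`. [folklore] -/
theorem rBasis_span : span ℤ (Set.range (rBasis L)) = L := (zBasis L).ofZLatticeBasis_span ℝ

/-- The basis vectors lie in `L`. [folklore] -/
theorem rBasis_mem (i : Fin (finrank ℝ E)) : rBasis L i ∈ L := by
  rw [rBasis, Basis.ofZLatticeBasis_apply]; exact (zBasis L i).2

/-- The coordinates of a lattice vector are integers. [folklore] -/
theorem rBasis_repr_of_mem {x : E} (hx : x ∈ L) (i : Fin (finrank ℝ E)) :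
    ∃ k : ℤ, (rBasis L).repr x i = k :=
  ⟨(zBasis L).repr ⟨x, hx⟩ i, by rw [rBasis, ← Basis.ofZLatticeBasis_repr_apply]⟩

/-- A vector with integer coordinates lies in `L`. [folklore] -/
theorem mem_of_rBasis_repr {x : E} (hx : ∀ i, ∃ k : ℤ, (rBasis L).repr x i = k) : x ∈ L := by
  rw [← rBasis_span L, Basis.mem_span_iff_repr_mem]
  intro i
  obtain ⟨k, hk⟩ := hx i
  exact ⟨k, by rw [hk]; simp⟩

/-- The fundamental parallelepiped of `rBasis`. [folklore] -/
def fdom : Set E := fundamentalDomain (rBasis L)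

/-- `fdom` is a fundamental domain for the translation action of `L`. [folklore] -/
theorem isAddFundamentalDomain [MeasurableSpace E] [OpensMeasurableSpace E] (μ : Measure E) :
    IsAddFundamentalDomain L (fdom L) μ :=
  ZLattice.isAddFundamentalDomain (zBasis L) μ

/-- `fdom` is bounded. [folklore] -/
theorem fdom_isBounded : Bornology.IsBounded (fdom L) := fundamentalDomain_isBounded _

/-- `fdom` is measurable. [folklore] -/
theorem fdom_measurableSet [MeasurableSpace E] [OpensMeasurableSpace E] : MeasurableSet (fdom L) :=
  fundamentalDomain_measurableSet _

section Measure

variable [MeasurableSpace E] [BorelSpace E] (μ : Measure E) [μ.IsAddHaarMeasure]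

omit [BorelSpace E] in
/-- `fdom` has finite measure. [folklore] -/
theorem measure_fdom_lt_top : μ (fdom L) < ⊤ := (fdom_isBounded L).measure_lt_top

/-- `fdom` has nonzero measure. [folklore] -/
theorem measure_fdom_ne_zero : μ (fdom L) ≠ 0 := measure_fundamentalDomain_ne_zero _

/-- `fdom` has positive real measure. [folklore] -/
theorem measureReal_fdom_pos : 0 < μ.real (fdom L) :=
  ENNReal.toReal_pos (measure_fdom_ne_zero L μ) (measure_fdom_lt_top L μ).ne

/-! ## The mean over a period -/

/-- The mean of `g` over the fundamental domain: `(μ(fdom))⁻¹ • ∫_{fdom} g`. [folklore] -/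
def mean {F : Type*} [NormedAddCommGroup F] [NormedSpace ℝ F] (g : E → F) : F :=
  (μ.real (fdom L))⁻¹ • ∫ x in fdom L, g x ∂μ

/-- The mean of a constant. [folklore] -/
theorem mean_const {F : Type*} [NormedAddCommGroup F] [NormedSpace ℝ F] [CompleteSpace F] (c : F) :
    mean L μ (fun _ ↦ c) = c := by
  rw [mean, setIntegral_const, ← smul_assoc, smul_eq_mul, inv_mul_cancel₀ (measureReal_fdom_pos L μ).ne',
    one_smul]

/-- The mean is bounded by any bound of the function. [folklore] -/
theorem norm_mean_le {F : Type*} [NormedAddCommGroup F] [NormedSpace ℝ F] {g : E → F} {C : ℝ}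
    (hg : ∀ x, ‖g x‖ ≤ C) : ‖mean L μ g‖ ≤ C := by
  have hpos := measureReal_fdom_pos L μ
  rw [mean, norm_smul, norm_inv, Real.norm_of_nonneg hpos.le]
  have h := norm_setIntegral_le_of_norm_le_const (measure_fdom_lt_top L μ) (fun x _ ↦ hg x) (μ := μ)
    (s := fdom L) (f := g)
  calc (μ.real (fdom L))⁻¹ * ‖∫ x in fdom L, g x ∂μ‖ ≤ (μ.real (fdom L))⁻¹ * (C * μ.real (fdom L)) :=
        mul_le_mul_of_nonneg_left h (inv_nonneg.2 hpos.le)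
    _ = C := by field_simp

omit [BorelSpace E] [μ.IsAddHaarMeasure] in
/-- The mean is additive (integrable functions). [folklore] -/
theorem mean_add {F : Type*} [NormedAddCommGroup F] [NormedSpace ℝ F] {f g : E → F}
    (hf : IntegrableOn f (fdom L) μ) (hg : IntegrableOn g (fdom L) μ) :
    mean L μ (fun x ↦ f x + g x) = mean L μ f + mean L μ g := by
  simp only [mean, integral_add hf hg, smul_add]

omit [BorelSpace E] [μ.IsAddHaarMeasure] in
/-- The mean is homogeneous. [folklore] -/
theorem mean_const_mul (c : ℂ) (f : E → ℂ) : mean L μ (fun x ↦ c * f x) = c * mean L μ f := by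
  unfold mean
  rw [integral_const_mul, mul_smul_comm]

omit [BorelSpace E] [μ.IsAddHaarMeasure] in
/-- The mean of a difference. [folklore] -/
theorem mean_sub {F : Type*} [NormedAddCommGroup F] [NormedSpace ℝ F] {f g : E → F}
    (hf : IntegrableOn f (fdom L) μ) (hg : IntegrableOn g (fdom L) μ) :
    mean L μ (fun x ↦ f x - g x) = mean L μ f - mean L μ g := by
  simp only [mean, integral_sub hf hg, smul_sub]

omit [BorelSpace E] [μ.IsAddHaarMeasure] in
/-- The mean of a finite sum. [folklore] -/
theorem mean_finset_sum {α : Type*} (s : Finset α) {f : α → E → ℂ}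
    (hf : ∀ a ∈ s, IntegrableOn (f a) (fdom L) μ) :
    mean L μ (fun x ↦ ∑ a ∈ s, f a x) = ∑ a ∈ s, mean L μ (f a) := by
  simp only [mean, integral_finsetSum s hf, smul_sum]

omit [BorelSpace E] [μ.IsAddHaarMeasure] in
/-- The mean of a real function, as a complex number. [folklore] -/
theorem mean_ofReal (g : E → ℝ) : ((mean L μ g : ℝ) : ℂ) = mean L μ (fun x ↦ (g x : ℂ)) := by
  rw [mean, mean, integral_complex_ofReal, Complex.real_smul, smul_eq_mul, Complex.ofReal_mul,
    Complex.ofReal_inv]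

/-- A continuous function is integrable on `fdom`. [folklore] -/
theorem integrableOn_fdom {F : Type*} [NormedAddCommGroup F] {g : E → F} (hg : Continuous g) :
    IntegrableOn g (fdom L) μ :=
  (hg.continuousOn.integrableOn_compact (μ := μ) (fdom_isBounded L).isCompact_closure).mono_set
    subset_closure

/-! ## Characters -/

/-- The character `e_k(x) = exp(2πi ∑ᵢ kᵢ xᵢ)` of `E/L` (`xᵢ` the coordinates in `rBasis`).
[folklore] -/
def echar (k : Fin (finrank ℝ E) → ℤ) (x : E) : ℂ :=
  Complex.exp (2 * π * Complex.I * (∑ i, (k i : ℝ) * (rBasis L).repr x i : ℝ))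

omit [MeasurableSpace E] [BorelSpace E] in
/-- The trivial character. [folklore] -/
theorem echar_zero (x : E) : echar L 0 x = 1 := by
  simp [echar]

omit [MeasurableSpace E] [BorelSpace E] in
/-- Characters are unimodular. [folklore] -/
theorem norm_echar (k : Fin (finrank ℝ E) → ℤ) (x : E) : ‖echar L k x‖ = 1 := by
  rw [echar, Complex.norm_exp]
  simp

omit [MeasurableSpace E] [BorelSpace E] in
/-- Characters are `L`-periodic. [folklore] -/
theorem echar_add_of_mem (k : Fin (finrank ℝ E) → ℤ) {ℓ : E} (hℓ : ℓ ∈ L) (x : E) :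
    echar L k (x + ℓ) = echar L k x := by
  unfold echar
  have hint : ∃ N : ℤ, (∑ i, (k i : ℝ) * (rBasis L).repr ℓ i) = N := by
    choose f hf using fun i ↦ rBasis_repr_of_mem L hℓ i
    exact ⟨∑ i, k i * f i, by push_cast; exact Finset.sum_congr rfl fun i _ ↦ by rw [hf i]⟩
  obtain ⟨N, hN⟩ := hint
  have : (∑ i, (k i : ℝ) * (rBasis L).repr (x + ℓ) i) = (∑ i, (k i : ℝ) * (rBasis L).repr x i) + N := by
    rw [← hN, ← Finset.sum_add_distrib]
    simp [mul_add]
  rw [this, Complex.ofReal_add, mul_add, Complex.exp_add]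
  have h1 : Complex.exp (2 * π * Complex.I * ((N : ℝ) : ℂ)) = 1 := by
    rw [Complex.exp_eq_one_iff]; exact ⟨N, by push_cast; ring⟩
  rw [h1, mul_one]

omit [MeasurableSpace E] [BorelSpace E] in
/-- Characters are continuous. [folklore] -/
theorem continuous_echar (k : Fin (finrank ℝ E) → ℤ) : Continuous (echar L k) := by
  unfold echar
  refine Complex.continuous_exp.comp (continuous_const.mul (Complex.continuous_ofReal.comp ?_))
  refine continuous_finsetSum _ fun i _ ↦ continuous_const.mul ?_
  exact (continuous_apply i).comp (rBasis L).equivFunL.continuous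

omit [MeasurableSpace E] [BorelSpace E] in
/-- Translation of a character. [folklore] -/
theorem echar_add (k : Fin (finrank ℝ E) → ℤ) (x v : E) : echar L k (x + v) = echar L k x * echar L k v := by
  unfold echar
  rw [← Complex.exp_add]
  congr 1
  simp only [map_add, Finsupp.coe_add, Pi.add_apply, mul_add, Finset.sum_add_distrib]
  push_cast
  ring

omit [MeasurableSpace E] [BorelSpace E] in
/-- A non-trivial character takes the value `-1` somewhere. [folklore] -/
theorem exists_echar_eq_neg_one {k : Fin (finrank ℝ E) → ℤ} (hk : k ≠ 0) : ∃ v : E, echar L k v = -1 := by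
  obtain ⟨i, hi⟩ : ∃ i, k i ≠ 0 := by
    by_contra h; push Not at h; exact hk (funext h)
  refine ⟨((2 * (k i : ℝ))⁻¹) • rBasis L i, ?_⟩
  unfold echar
  have hsum : (∑ j, (k j : ℝ) * (rBasis L).repr (((2 * (k i : ℝ))⁻¹) • rBasis L i) j) = 1 / 2 := by
    simp only [map_smul, Basis.repr_self, Finsupp.coe_smul, Pi.smul_apply, smul_eq_mul]
    rw [Finset.sum_eq_single i]
    · rw [Finsupp.single_eq_same]
      have : (k i : ℝ) ≠ 0 := by exact_mod_cast hi
      field_simp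
    · intro j _ hj; rw [Finsupp.single_apply, if_neg (Ne.symm hj)]; ring
    · intro h; exact absurd (Finset.mem_univ i) h
  rw [hsum]
  have : 2 * (π : ℂ) * Complex.I * ((1 / 2 : ℝ) : ℂ) = π * Complex.I := by push_cast; ring
  rw [this, Complex.exp_pi_mul_I]

/-- **The mean of a non-trivial character vanishes** (translation trick: a translate of the
fundamental domain is again one, and translating multiplies the integral by `e_k(v) = -1`).
[folklore] -/
theorem mean_echar {k : Fin (finrank ℝ E) → ℤ} (hk : k ≠ 0) : mean L μ (echar L k) = 0 := by
  obtain ⟨v, hv⟩ := exists_echar_eq_neg_one L hk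
  have : MeasurableVAdd L E := (inferInstance : MeasurableVAdd L.toAddSubgroup E)
  have : VAddInvariantMeasure L E μ := (inferInstance : VAddInvariantMeasure L.toAddSubgroup E μ)
  have hD := isAddFundamentalDomain L μ
  -- the translate `fdom + v` is a fundamental domain
  have hD' : IsAddFundamentalDomain L ((Equiv.addRight v) '' fdom L) μ := by
    refine hD.image_of_equiv (Equiv.addRight v) ?_ (Equiv.refl L) fun g x ↦ ?_
    · rw [Equiv.addRight_symm]
      exact (measurePreserving_add_right μ (-v)).quasiMeasurePreserving
    · simp only [Equiv.coe_addRight, Equiv.refl_apply, Submodule.vadd_def, vadd_eq_add, add_assoc]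
  have hper : ∀ (g : L) (x : E), echar L k (g +ᵥ x) = echar L k x := fun g x ↦ by
    rw [Submodule.vadd_def, vadd_eq_add, add_comm, echar_add_of_mem L k g.2]
  have h1 : ∫ x in fdom L, echar L k x ∂μ = ∫ x in (Equiv.addRight v) '' fdom L, echar L k x ∂μ :=
    hD.setIntegral_eq hD' hper
  have h2 : ∫ x in (Equiv.addRight v) '' fdom L, echar L k x ∂μ = ∫ x in fdom L, echar L k (x + v) ∂μ :=
    (measurePreserving_add_right μ v).setIntegral_image_emb (measurableEmbedding_addRight v) _ _
  have h3 : ∫ x in fdom L, echar L k (x + v) ∂μ = -∫ x in fdom L, echar L k x ∂μ := by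
    simp only [echar_add, hv, mul_neg, mul_one, integral_neg]
  have h0 : ∫ x in fdom L, echar L k x ∂μ = 0 := by
    have := h1.trans (h2.trans h3)
    linear_combination this / 2
  rw [mean, h0, smul_zero]

/-- The mean of the trivial character is `1`. [folklore] -/
theorem mean_echar_zero : mean L μ (echar L 0) = 1 := by
  have : echar L 0 = fun _ ↦ (1 : ℂ) := funext (echar_zero L)
  rw [this]; exact mean_const L μ 1

end Measure

/-! ## Transport to the standard torus and density of trigonometric polynomials -/

section Density

/-- The point of the standard torus `(ℝ/ℤ)^n` attached to `x` (its coordinates mod `1`). [folklore] -/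
def toTorus (x : E) : UnitAddTorus (Fin (finrank ℝ E)) := fun i ↦ ((rBasis L).repr x i : UnitAddCircle)

/-- The characters are the pull-backs of Mathlib's Fourier monomials. [folklore] -/
theorem echar_eq_mFourier (k : Fin (finrank ℝ E) → ℤ) (x : E) :
    echar L k x = UnitAddTorus.mFourier k (toTorus L x) := by
  unfold echar toTorus
  simp only [UnitAddTorus.mFourier, ContinuousMap.coe_mk, fourier_coe_apply]
  rw [Complex.ofReal_sum, Finset.mul_sum, Complex.exp_sum]
  refine Finset.prod_congr rfl fun i _ ↦ ?_
  congr 1; push_cast; ring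

/-- Coordinates of the inverse coordinate map. [folklore] -/
theorem repr_equivFunL_symm (u : Fin (finrank ℝ E) → ℝ) (i : Fin (finrank ℝ E)) :
    (rBasis L).repr ((rBasis L).equivFunL.symm u) i = u i := by
  have h : (rBasis L).equivFunL ((rBasis L).equivFunL.symm u) = u := (rBasis L).equivFunL.apply_symm_apply u
  have h2 : (rBasis L).equivFunL ((rBasis L).equivFunL.symm u) i =
      (rBasis L).repr ((rBasis L).equivFunL.symm u) i := by
    simp [Basis.equivFunL_apply]
  rw [← h2, h]

/-- A (discontinuous) section of `toTorus`. [folklore] -/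
def liftTorus (t : UnitAddTorus (Fin (finrank ℝ E))) : E := (rBasis L).equivFunL.symm fun i ↦ (t i).out

/-- `toTorus ∘ liftTorus = id`. [folklore] -/
theorem toTorus_liftTorus (t : UnitAddTorus (Fin (finrank ℝ E))) : toTorus L (liftTorus L t) = t := by
  funext i
  simp only [toTorus, liftTorus, repr_equivFunL_symm]
  exact QuotientAddGroup.out_eq' (t i)

/-- Two vectors with the same torus point differ by a lattice vector. [folklore] -/
theorem sub_mem_of_toTorus_eq {x x' : E} (h : toTorus L x = toTorus L x') : x - x' ∈ L := by
  refine mem_of_rBasis_repr L fun i ↦ ?_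
  have hi := congrFun h i
  simp only [toTorus] at hi
  rw [QuotientAddGroup.eq] at hi
  obtain ⟨k, hk⟩ := AddSubgroup.mem_zmultiples_iff.1 hi
  refine ⟨-k, ?_⟩
  rw [map_sub, Finsupp.coe_sub, Pi.sub_apply]
  simp only [zsmul_eq_mul, mul_one] at hk
  push_cast
  linarith

variable {L} in
/-- A periodic function descends to the torus: `g ∘ liftTorus`. [folklore] -/
def descend (g : E → ℂ) : UnitAddTorus (Fin (finrank ℝ E)) → ℂ := fun t ↦ g (liftTorus L t)

variable {L}

/-- The descended function recovers `g`. [folklore] -/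
theorem descend_toTorus {g : E → ℂ} (hper : ∀ ℓ ∈ L, ∀ x, g (x + ℓ) = g x) (x : E) :
    descend (L := L) g (toTorus L x) = g x := by
  unfold descend
  have hmem := sub_mem_of_toTorus_eq L (toTorus_liftTorus L (toTorus L x))
  have := hper _ hmem x
  rwa [add_sub_cancel] at this

/-- The descended function of a continuous periodic function is continuous (the coordinate map to
the torus is an open quotient map). [folklore] -/
theorem continuous_descend {g : E → ℂ} (hg : Continuous g) (hper : ∀ ℓ ∈ L, ∀ x, g (x + ℓ) = g x) :
    Continuous (descend (L := L) g) := by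
  set pr : (Fin (finrank ℝ E) → ℝ) → UnitAddTorus (Fin (finrank ℝ E)) :=
    Pi.map fun _ (u : ℝ) ↦ (u : UnitAddCircle) with hpr
  have hopen : IsOpenQuotientMap pr := IsOpenQuotientMap.piMap fun _ ↦ QuotientAddGroup.isOpenQuotientMap_mk
  rw [← hopen.continuous_comp_iff]
  have heq : descend (L := L) g ∘ pr = g ∘ (rBasis L).equivFunL.symm := by
    funext u
    have h1 : pr u = toTorus L ((rBasis L).equivFunL.symm u) := by
      funext i
      simp only [hpr, Pi.map_apply, toTorus, repr_equivFunL_symm]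
    simp only [Function.comp_apply, h1, descend_toTorus hper]
  rw [heq]
  exact hg.comp (rBasis L).equivFunL.symm.continuous

/-- **Density of trigonometric polynomials**: a continuous `L`-periodic function is uniformly
approximated by finite linear combinations of the characters `echar k`.
[cite: HeckeMathZ1920, §6 (Weyl's criterion)] -/
theorem exists_trigPoly_approx {g : E → ℂ} (hg : Continuous g) (hper : ∀ ℓ ∈ L, ∀ x, g (x + ℓ) = g x)
    {ε : ℝ} (hε : 0 < ε) :
    ∃ (s : Finset (Fin (finrank ℝ E) → ℤ)) (c : (Fin (finrank ℝ E) → ℤ) → ℂ),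
      ∀ x, ‖g x - ∑ k ∈ s, c k * echar L k x‖ ≤ ε := by
  set G : C(UnitAddTorus (Fin (finrank ℝ E)), ℂ) := ⟨descend (L := L) g, continuous_descend hg hper⟩ with hG
  have hGmem : G ∈ ((span ℂ (Set.range (UnitAddTorus.mFourier (d := Fin (finrank ℝ E))))).topologicalClosure :
      Set C(UnitAddTorus (Fin (finrank ℝ E)), ℂ)) := by
    rw [UnitAddTorus.span_mFourier_closure_eq_top]; trivial
  rw [Submodule.topologicalClosure_coe, Metric.mem_closure_iff] at hGmem
  obtain ⟨P, hP, hdist⟩ := hGmem ε hε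
  obtain ⟨c, rfl⟩ := (Finsupp.mem_span_range_iff_exists_finsupp.1 hP)
  refine ⟨c.support, fun k ↦ c k, fun x ↦ ?_⟩
  have hPx : (c.sum fun k a ↦ a • UnitAddTorus.mFourier k) (toTorus L x) = ∑ k ∈ c.support, c k * echar L k x := by
    rw [Finsupp.sum, ContinuousMap.coe_sum, Finset.sum_apply]
    refine Finset.sum_congr rfl fun k _ ↦ ?_
    rw [ContinuousMap.coe_smul, Pi.smul_apply, smul_eq_mul, echar_eq_mFourier]
  rw [← hPx, ← descend_toTorus hper x]
  change ‖(G - c.sum fun k a ↦ a • UnitAddTorus.mFourier k) (toTorus L x)‖ ≤ ε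
  refine ((ContinuousMap.norm_coe_le_norm _ _).trans ?_)
  rw [← dist_eq_norm]; exact hdist.le

end Density

/-! ## Periodization of compactly supported functions -/

section Periodize

variable {L}

/-- The lattice points of norm `≤ ρ`, a finite set. [folklore] -/
theorem finite_norm_le (ρ : ℝ) : {ℓ : L | ‖(ℓ : E)‖ ≤ ρ}.Finite := by
  have h : (Metric.closedBall (0 : E) ρ ∩ (L : Set E)).Finite := by
    rw [← rBasis_span L]
    exact ZSpan.setFinite_inter _ Metric.isBounded_closedBall
  refine (h.preimage (Subtype.val_injective.injOn)).subset fun ℓ hℓ ↦ ?_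
  exact ⟨by simpa using hℓ, ℓ.2⟩

/-- The lattice points of norm `≤ ρ` as a `Finset`. [folklore] -/
def ballPts (ρ : ℝ) : Finset L := (finite_norm_le (L := L) ρ).toFinset

/-- Membership in `ballPts`. [folklore] -/
theorem mem_ballPts {ρ : ℝ} {ℓ : L} : ℓ ∈ ballPts (L := L) ρ ↔ ‖(ℓ : E)‖ ≤ ρ := by
  rw [ballPts, Set.Finite.mem_toFinset]; rfl

variable (L) in
/-- The periodization `∑_{ℓ ∈ L} h(x + ℓ)`. [folklore] -/
def periodize (h : E → ℝ) (x : E) : ℝ := ∑' ℓ : L, h (x + ℓ)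

/-- Outside `ballPts (R + R')` the terms of the periodization vanish at the points of norm `≤ R'`,
when `h` vanishes outside the ball of radius `R`. [folklore] -/
theorem apply_add_eq_zero {h : E → ℝ} {R : ℝ} (hh : ∀ y, R < ‖y‖ → h y = 0) {R' : ℝ} {x : E}
    (hx : ‖x‖ ≤ R') {ℓ : L} (hℓ : ℓ ∉ ballPts (L := L) (R + R')) : h (x + ℓ) = 0 := by
  rw [mem_ballPts, not_le] at hℓ
  apply hh
  have := norm_sub_norm_le (ℓ : E) (-x)
  rw [sub_neg_eq_add, norm_neg, add_comm (ℓ : E)] at this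
  linarith

/-- On the ball of radius `R'` the periodization is a finite sum. [folklore] -/
theorem periodize_eq_sum {h : E → ℝ} {R : ℝ} (hh : ∀ y, R < ‖y‖ → h y = 0) {R' : ℝ} {x : E}
    (hx : ‖x‖ ≤ R') : periodize L h x = ∑ ℓ ∈ ballPts (L := L) (R + R'), h (x + ℓ) :=
  tsum_eq_sum fun _ hℓ ↦ apply_add_eq_zero hh hx hℓ

/-- The terms of the periodization are summable (finitely many are nonzero). [folklore] -/
theorem summable_apply_add {h : E → ℝ} {R : ℝ} (hh : ∀ y, R < ‖y‖ → h y = 0) (x : E) :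
    Summable fun ℓ : L ↦ h (x + ℓ) :=
  summable_of_hasFiniteSupport ((ballPts (L := L) (R + ‖x‖)).finite_toSet.subset fun _ hℓ ↦ by
    by_contra h'; exact hℓ (apply_add_eq_zero hh le_rfl h'))

/-- **The periodization of a continuous compactly supported function is continuous.** [folklore] -/
theorem continuous_periodize {h : E → ℝ} (hc : Continuous h) {R : ℝ} (hh : ∀ y, R < ‖y‖ → h y = 0) :
    Continuous (periodize L h) := by
  refine continuous_iff_continuousAt.2 fun x₀ ↦ ?_
  have hloc : ∀ x ∈ Metric.ball x₀ 1, periodize L h x = ∑ ℓ ∈ ballPts (L := L) (R + (‖x₀‖ + 1)), h (x + ℓ) := by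
    intro x hx
    refine periodize_eq_sum hh ?_
    have := norm_sub_norm_le x x₀
    rw [Metric.mem_ball, dist_eq_norm] at hx
    linarith
  have hcont : Continuous fun x ↦ ∑ ℓ ∈ ballPts (L := L) (R + (‖x₀‖ + 1)), h (x + ℓ) :=
    continuous_finsetSum _ fun ℓ _ ↦ hc.comp (continuous_id.add continuous_const)
  refine hcont.continuousAt.congr (Filter.eventuallyEq_of_mem (Metric.ball_mem_nhds x₀ one_pos) ?_)
  exact fun x hx ↦ (hloc x hx).symm

omit [NormedSpace ℝ E] [FiniteDimensional ℝ E] [DiscreteTopology L] [IsZLattice ℝ L] in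
/-- **The periodization is `L`-periodic.** [folklore] -/
theorem periodize_add_of_mem (h : E → ℝ) {ℓ₀ : E} (hℓ₀ : ℓ₀ ∈ L) (x : E) :
    periodize L h (x + ℓ₀) = periodize L h x := by
  unfold periodize
  have : (fun ℓ : L ↦ h (x + ℓ₀ + ℓ)) = fun ℓ : L ↦ h (x + ((Equiv.addLeft (⟨ℓ₀, hℓ₀⟩ : L) ℓ : L) : E)) := by
    funext ℓ; simp [add_assoc]
  rw [this]
  exact (Equiv.addLeft (⟨ℓ₀, hℓ₀⟩ : L)).tsum_eq (fun ℓ : L ↦ h (x + (ℓ : E)))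

/-- The periodization is monotone (functions vanishing outside balls). [folklore] -/
theorem periodize_mono {h₁ h₂ : E → ℝ} {R₁ R₂ : ℝ} (hh₁ : ∀ y, R₁ < ‖y‖ → h₁ y = 0)
    (hh₂ : ∀ y, R₂ < ‖y‖ → h₂ y = 0) (hle : ∀ y, h₁ y ≤ h₂ y) (x : E) :
    periodize L h₁ x ≤ periodize L h₂ x :=
  (summable_apply_add hh₁ x).tsum_le_tsum (fun _ ↦ hle _) (summable_apply_add hh₂ x)

omit [NormedSpace ℝ E] [FiniteDimensional ℝ E] [DiscreteTopology L] [IsZLattice ℝ L] in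
/-- The periodization of a nonnegative function is nonnegative. [folklore] -/
theorem periodize_nonneg {h : E → ℝ} (hle : ∀ y, 0 ≤ h y) (x : E) : 0 ≤ periodize L h x :=
  tsum_nonneg fun _ ↦ hle _

/-- The periodization dominates each term (nonnegative `h`). [folklore] -/
theorem apply_le_periodize {h : E → ℝ} {R : ℝ} (hh : ∀ y, R < ‖y‖ → h y = 0) (hle : ∀ y, 0 ≤ h y)
    (x : E) (ℓ : L) : h (x + ℓ) ≤ periodize L h x :=
  (summable_apply_add hh x).le_tsum ℓ fun _ _ ↦ hle _

variable [MeasurableSpace E] [BorelSpace E] (μ : Measure E) [μ.IsAddHaarMeasure]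

/-- **Unfolding**: `∫_{fdom} ∑_{ℓ} h(x + ℓ) dx = ∫_E h`. [folklore] -/
theorem integral_fdom_periodize {h : E → ℝ} (hc : Continuous h) {R : ℝ} (hh : ∀ y, R < ‖y‖ → h y = 0) :
    ∫ x in fdom L, periodize L h x ∂μ = ∫ x, h x ∂μ := by
  have : MeasurableVAdd L E := (inferInstance : MeasurableVAdd L.toAddSubgroup E)
  have : VAddInvariantMeasure L E μ := (inferInstance : VAddInvariantMeasure L.toAddSubgroup E μ)
  -- a bound for the fundamental domain
  obtain ⟨RD, hRD⟩ := isBounded_iff_forall_norm_le.1 (fdom_isBounded L)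
  -- `h` is integrable (continuous, compact support)
  have hsupp : HasCompactSupport h := by
    refine HasCompactSupport.of_support_subset_isCompact (isCompact_closedBall (0 : E) R) fun y hy ↦ ?_
    rw [Metric.mem_closedBall, dist_zero_right]
    by_contra h'; exact hy (hh y (not_le.1 h'))
  have hint : Integrable h μ := hc.integrable_of_hasCompactSupport hsupp
  rw [(isAddFundamentalDomain L μ).integral_eq_tsum'' h hint]
  -- both sides are finite sums over `ballPts (R + RD)`
  have hvadd : ∀ (ℓ : L) (x : E), ℓ +ᵥ x = x + (ℓ : E) := fun ℓ x ↦ by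
    rw [Submodule.vadd_def, vadd_eq_add, add_comm]
  simp_rw [hvadd]
  have hzero : ∀ ℓ : L, ℓ ∉ ballPts (L := L) (R + RD) → ∫ x in fdom L, h (x + ℓ) ∂μ = 0 := by
    intro ℓ hℓ
    refine setIntegral_eq_zero_of_forall_eq_zero fun x hx ↦ ?_
    exact apply_add_eq_zero hh (hRD x hx) hℓ
  rw [tsum_eq_sum (s := ballPts (L := L) (R + RD)) (fun ℓ hℓ ↦ hzero ℓ hℓ)]
  rw [← integral_finsetSum (ballPts (L := L) (R + RD)) (f := fun (ℓ : L) (x : E) ↦ h (x + (ℓ : E)))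
    (fun ℓ _ ↦ (integrableOn_fdom L μ (by fun_prop) : IntegrableOn (fun x : E ↦ h (x + (ℓ : E))) (fdom L) μ))]
  refine setIntegral_congr_fun (fdom_measurableSet L) fun x hx ↦ ?_
  exact periodize_eq_sum hh (hRD x hx)

/-- **The mean of a periodization** is `(μ(fdom))⁻¹ ∫ h`. [folklore] -/
theorem mean_periodize {h : E → ℝ} (hc : Continuous h) {R : ℝ} (hh : ∀ y, R < ‖y‖ → h y = 0) :
    mean L μ (periodize L h) = (μ.real (fdom L))⁻¹ * ∫ x, h x ∂μ := by
  rw [mean, integral_fdom_periodize μ hc hh, smul_eq_mul]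

end Periodize

/-! ## Weyl's criterion with weights -/

section Weyl

variable [MeasurableSpace E] [BorelSpace E] (μ : Measure E) [μ.IsAddHaarMeasure]

/-- **Weyl's criterion with weights and normalisation `x/(log x)^κ`.** If the character sums over a
family of finite multisets of points of `E` satisfy
`(∑_{m ≤ x} ∑_{i ∈ S m} e_k(y_i)) (log x)^κ/x → c·[k = 0]`, then for every continuous `L`-periodic
real `g`, `(∑_{m ≤ x} ∑_{i ∈ S m} g(y_i)) (log x)^κ/x → c · mean g`.
[cite: HeckeMathZ1920, §6 (Weyl's criterion)] -/
theorem tendsto_sum_of_tendsto_echar {ι : Type*} (S : ℕ → Finset ι) (y : ι → E) (κ : ℕ) {c : ℝ}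
    (hc : 0 ≤ c)
    (h : ∀ k : Fin (finrank ℝ E) → ℤ,
      Tendsto (fun x : ℝ ↦ (∑ m ∈ Icc 1 ⌊x⌋₊, ∑ i ∈ S m, echar L k (y i)) * ((Real.log x) ^ κ / x : ℝ))
        atTop (𝓝 (if k = 0 then (c : ℂ) else 0)))
    {g : E → ℝ} (hg : Continuous g) (hper : ∀ ℓ ∈ L, ∀ x, g (x + ℓ) = g x) :
    Tendsto (fun x : ℝ ↦ (∑ m ∈ Icc 1 ⌊x⌋₊, ∑ i ∈ S m, g (y i)) * ((Real.log x) ^ κ / x))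
      atTop (𝓝 (c * mean L μ g)) := by
  -- complex version
  set gc : E → ℂ := fun x ↦ (g x : ℂ) with hgc
  have hgc_cont : Continuous gc := Complex.continuous_ofReal.comp hg
  have hgc_per : ∀ ℓ ∈ L, ∀ x, gc (x + ℓ) = gc x := fun ℓ hℓ x ↦ by simp only [hgc, hper ℓ hℓ x]
  -- the counting function
  set N : ℝ → ℝ := fun x ↦ ∑ m ∈ Icc 1 ⌊x⌋₊, ((S m).card : ℝ) with hN
  have hN_tendsto : Tendsto (fun x ↦ N x * ((Real.log x) ^ κ / x)) atTop (𝓝 c) := by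
    have h0 := h 0
    simp only [echar_zero, Finset.sum_const, nsmul_eq_mul, mul_one, if_true] at h0
    have : (fun x : ℝ ↦ (∑ m ∈ Icc 1 ⌊x⌋₊, ((S m).card : ℂ)) * (((Real.log x) ^ κ / x : ℝ) : ℂ)) =
        fun x ↦ ((N x * ((Real.log x) ^ κ / x) : ℝ) : ℂ) := by
      funext x; simp only [hN]; push_cast; ring
    rw [this] at h0
    simpa only [Function.comp_def, Complex.ofReal_re] using (Complex.continuous_re.tendsto _).comp h0
  rw [Metric.tendsto_nhds]
  intro ε hε
  set η : ℝ := ε / (2 * c + 3) with hη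
  have hη0 : 0 < η := div_pos hε (by linarith)
  obtain ⟨s, cf, hP⟩ := exists_trigPoly_approx (L := L) hgc_cont hgc_per hη0
  -- the character sums
  set T : (Fin (finrank ℝ E) → ℤ) → ℝ → ℂ :=
    fun k x ↦ (∑ m ∈ Icc 1 ⌊x⌋₊, ∑ i ∈ S m, echar L k (y i)) * (((Real.log x) ^ κ / x : ℝ) : ℂ) with hT
  set c₀ : ℂ := ∑ k ∈ s, if k = 0 then cf k else 0 with hc₀
  have hB : Tendsto (fun x ↦ ∑ k ∈ s, cf k * T k x) atTop (𝓝 ((c : ℂ) * c₀)) := by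
    have : (c : ℂ) * c₀ = ∑ k ∈ s, cf k * (if k = 0 then (c : ℂ) else 0) := by
      rw [hc₀, Finset.mul_sum]
      refine Finset.sum_congr rfl fun k _ ↦ ?_
      split_ifs <;> ring
    rw [this]
    exact tendsto_finsetSum _ fun k _ ↦ (h k).const_mul _
  -- the mean of the trigonometric polynomial is `c₀`, within `η` of `mean g`
  have hmeanP : mean L μ (fun x ↦ ∑ k ∈ s, cf k * echar L k x) = c₀ := by
    rw [mean_finset_sum L μ s (fun k _ ↦ integrableOn_fdom L μ ((continuous_echar L k).const_smul (cf k) |>.congr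
      fun x ↦ by rfl))]
    refine Finset.sum_congr rfl fun k _ ↦ ?_
    rw [mean_const_mul]
    split_ifs with hk
    · rw [hk, mean_echar_zero, mul_one]
    · rw [mean_echar L μ hk, mul_zero]
  have hmean_close : ‖c₀ - ((mean L μ g : ℝ) : ℂ)‖ ≤ η := by
    have hf : IntegrableOn (fun x ↦ ∑ k ∈ s, cf k * echar L k x) (fdom L) μ :=
      integrableOn_fdom L μ (continuous_finsetSum _ fun k _ ↦ continuous_const.mul (continuous_echar L k))
    have hg' : IntegrableOn (fun x ↦ (g x : ℂ)) (fdom L) μ := integrableOn_fdom L μ hgc_cont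
    rw [← hmeanP, mean_ofReal, ← mean_sub L μ hf hg']
    refine norm_mean_le L μ fun x ↦ ?_
    rw [← norm_neg, neg_sub]; exact hP x
  -- eventual bounds
  have hev1 : ∀ᶠ x : ℝ in atTop, N x * ((Real.log x) ^ κ / x) ≤ c + 1 := by
    have := (Metric.tendsto_nhds.1 hN_tendsto) 1 one_pos
    filter_upwards [this] with x hx
    rw [Real.dist_eq] at hx
    have := (abs_lt.1 hx).2; linarith
  have hev2 : ∀ᶠ x : ℝ in atTop, ‖(∑ k ∈ s, cf k * T k x) - c * c₀‖ < η := by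
    have := (Metric.tendsto_nhds.1 hB) η hη0
    filter_upwards [this] with x hx
    rwa [dist_eq_norm] at hx
  filter_upwards [hev1, hev2, eventually_ge_atTop (1 : ℝ)] with x hx1 hx2 hx3
  -- the weight is nonnegative
  have hw : 0 ≤ (Real.log x) ^ κ / x := div_nonneg (pow_nonneg (Real.log_nonneg hx3) _) (by linarith)
  -- compare the `g`-sum with the `P`-sum
  have hPsum : ∑ k ∈ s, cf k * T k x =
      (∑ m ∈ Icc 1 ⌊x⌋₊, ∑ i ∈ S m, ∑ k ∈ s, cf k * echar L k (y i)) * (((Real.log x) ^ κ / x : ℝ) : ℂ) := by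
    have hk : ∀ k ∈ s, cf k * T k x =
        (∑ m ∈ Icc 1 ⌊x⌋₊, ∑ i ∈ S m, cf k * echar L k (y i)) * (((Real.log x) ^ κ / x : ℝ) : ℂ) :=
      fun k _ ↦ by simp only [hT, Finset.mul_sum, Finset.sum_mul, mul_assoc]
    rw [Finset.sum_congr rfl hk, ← Finset.sum_mul, Finset.sum_comm]
    exact congrArg (· * _) (Finset.sum_congr rfl fun m _ ↦ Finset.sum_comm)
  have hdiff : ‖((∑ m ∈ Icc 1 ⌊x⌋₊, ∑ i ∈ S m, g (y i)) * ((Real.log x) ^ κ / x) : ℝ) -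
      (∑ k ∈ s, cf k * T k x : ℂ)‖ ≤ η * (N x * ((Real.log x) ^ κ / x)) := by
    rw [hPsum, Complex.ofReal_mul, Complex.ofReal_sum]
    simp_rw [Complex.ofReal_sum]
    rw [← sub_mul, ← Finset.sum_sub_distrib, norm_mul, Complex.norm_real, Real.norm_of_nonneg hw,
      ← mul_assoc]
    refine mul_le_mul_of_nonneg_right ?_ hw
    refine (norm_sum_le _ _).trans ?_
    simp only [hN, Finset.mul_sum]
    refine Finset.sum_le_sum fun m _ ↦ ?_
    rw [← Finset.sum_sub_distrib]
    refine (norm_sum_le _ _).trans ?_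
    rw [mul_comm, ← nsmul_eq_mul, ← Finset.sum_const]
    exact Finset.sum_le_sum fun i _ ↦ hP (y i)
  rw [dist_eq_norm]
  have hkey : ‖(((∑ m ∈ Icc 1 ⌊x⌋₊, ∑ i ∈ S m, g (y i)) * ((Real.log x) ^ κ / x) : ℝ) : ℂ) -
      ((c * (mean L μ g : ℝ) : ℝ) : ℂ)‖ < ε := by
    have e1 : (((∑ m ∈ Icc 1 ⌊x⌋₊, ∑ i ∈ S m, g (y i)) * ((Real.log x) ^ κ / x) : ℝ) : ℂ) -
        ((c * (mean L μ g : ℝ) : ℝ) : ℂ) =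
        ((((∑ m ∈ Icc 1 ⌊x⌋₊, ∑ i ∈ S m, g (y i)) * ((Real.log x) ^ κ / x) : ℝ) : ℂ) - ∑ k ∈ s, cf k * T k x) +
          ((∑ k ∈ s, cf k * T k x) - c * c₀) + (c : ℂ) * (c₀ - ((mean L μ g : ℝ) : ℂ)) := by
      push_cast; ring
    rw [e1]
    refine (norm_add₃_le).trans_lt ?_
    have h3 : ‖(c : ℂ) * (c₀ - ((mean L μ g : ℝ) : ℂ))‖ ≤ c * η := by
      rw [norm_mul, Complex.norm_real, Real.norm_of_nonneg hc]
      exact mul_le_mul_of_nonneg_left hmean_close hc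
    have h1 : ‖((((∑ m ∈ Icc 1 ⌊x⌋₊, ∑ i ∈ S m, g (y i)) * ((Real.log x) ^ κ / x) : ℝ) : ℂ) -
        ∑ k ∈ s, cf k * T k x)‖ ≤ η * (c + 1) :=
      hdiff.trans (mul_le_mul_of_nonneg_left hx1 hη0.le)
    have : η * (c + 1) + η + c * η < ε := by
      rw [hη]
      have h23 : (0 : ℝ) < 2 * c + 3 := by linarith
      rw [div_mul_eq_mul_div, ← add_div, mul_div_assoc', ← add_div, div_lt_iff₀ h23]
      nlinarith
    linarith [hx2.le]
  rwa [← Complex.ofReal_sub, Complex.norm_real, Real.norm_eq_abs, ← Real.dist_eq] at hkey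

end Weyl

end Literature.Algebra.EuclideanLattices.LatticePeriodic

end
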